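import Mathlib
import Summits.ResolutionOfSingularities.ResolutionOfSingularities.Theorems.WildQuotientsWildQuotientResolutionS1PlanarFieldDefs
import Summits.ResolutionOfSingularities.ResolutionOfSingularities.Theorems.WildConesClassicalRegimesStubMuDropCharTwoOrdPLeaves
import Literature.RingTheory.MvPowerSeries.FiniteColength
import Literature.AlgebraicGeometry.Resolution.CobordantArcLemma

/-!
(FILE 1/3 of the toolkit: Part I — `IsolatedSucc`; split for the 400-line cap by the filer res-L1-w45c-stub-2, decls VERBATIM from res-L1-w45c-idea-1 `w1n/S1W1NTransport.lean` 5281fd5e869a68b1)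

# S1 / W1N cascade — planar-field TRANSPORT TOOLKIT: `IsolatedSucc` (Part I) + brick B3 (Part II)

FILING NOTE.  This file SUPERSEDES `S1W1NIsolatedSucc.lean` (a15dcc7e369fc152) for landing purposes:
Part I below is that file's declarations verbatim; Part II adds brick B3 of the line card
`W1N-LINE.md` (affine transport of `IsSucc`: `shear`, `swapField`, invariance of `milnor` /
`IsIsolated` / `IsSingular` / `IsBadNode` / `linearPart = 0`, and the reduction principle
`forall_isSucc_of_chart1_zero`).  Land ONE of the two, not both (same namespace, same names).

## Part I — support `IsolatedSucc`: successors of an isolated node are isolated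

Crux stmt-ResolutionOfSingularities-17941 (`WildQuotients.CyclicQuotientFourfolds`), S1a line `s1a-logminvertex`,
stub `stub_W1N_print`, sub-line `w1n-cascade` (idea-1 `W1N-LINE.md`): the second of the five supports of
`S1.W1NCascade.W1NPrint_of_cascade`.  [OURS · L1 W4.5c] — NOT a statement of the manuscript; counted 0 post-V5.

THEOREM `PlanarField.isIsolated_of_isSucc`: if `θ = (a, b)` is isolated (`κ⟦x,y⟧/(a,b)` finite over `κ`) and
`θ.IsSucc θ'` (D1: `θ'` is the SATURATED transform of `θ` in chart 1 at some `c`, or in chart 2) then `θ'` is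
isolated.

PROOF (characteristic-free, no Noether).  Chart 1 (`π : x ↦ x, y ↦ x(y + c)`): `𝔪^k ≤ (a, b)` for some `k`
(finite colength), so `x^k = u a + v b`; substituting, `x^k = (u∘π)(a∘π) + (v∘π)(b∘π)` with
`a∘π = x^s a'`, `b∘π = x^{s+1} b' + (y + c) x^s a'` — hence `x^k ∈ (a', b')`.  Saturation says `x ∤ a'` or
`x ∤ b'`; if `x ∤ g` with `g ∈ {a', b'}` then `κ⟦x,y⟧/(x, g)` is finite (its dimension is the `y`-order of
`g(0, y)`: tree `MuDropCharTwoOrdP.colength_X_eq_order`), so `𝔪^M ≤ (x, g)` and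
`𝔪^{M(k+1)} ≤ (x, g)^{k+1} ≤ (x^k) + (g) ≤ (a', b')`: finite colength.  Chart 2 is the same with `x ↔ y`
(transported through the swap automorphism of `κ⟦x,y⟧`).

With the cascade file (`S1.W1NCascade`) in scope,
`theorem isolatedSucc : S1.W1NCascade.IsolatedSucc := fun κ _ θ θ' h₁ h₂ => PlanarField.isIsolated_of_isSucc θ θ' h₁ h₂`.
-/

-- single-problem summit: the doubled namespace component `ResolutionOfSingularities` is forced
set_option linter.dupNamespace false

noncomputable section

open MvPowerSeries IsLocalRing
open Literature.AlgebraicGeometry.Resolution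
open Summit.ResolutionOfSingularities.ResolutionOfSingularities.Theorems.WildCones.MuDropCharTwoOrdP

namespace Summit.ResolutionOfSingularities.ResolutionOfSingularities.Theorems.WildQuotientResolution.S1.PlanarField

variable {κ : Type} [Field κ]

/-! ## Finite colength from a power of the maximal ideal -/

/-- `𝔪^M ≤ I` ⇒ `κ⟦x,y⟧/I` finite over `κ`. [folklore] -/
theorem finite_quot_of_maximalIdeal_pow_le {I : Ideal (MvPowerSeries (Fin 2) κ)} {M : ℕ}
    (hM : maximalIdeal (MvPowerSeries (Fin 2) κ) ^ M ≤ I) :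
    Module.Finite κ (MvPowerSeries (Fin 2) κ ⧸ I) := by
  haveI := Literature.RingTheory.MvPowerSeries.Jets.finite_quotient_maximalIdeal_pow (σ := Fin 2) (K := κ) M
  refine Module.Finite.of_surjective
    (Ideal.Quotient.factorₐ κ hM : (MvPowerSeries (Fin 2) κ ⧸ maximalIdeal (MvPowerSeries (Fin 2) κ) ^ M) →ₗ[κ]
      MvPowerSeries (Fin 2) κ ⧸ I) ?_
  exact Ideal.Quotient.factor_surjective hM

/-- `x ∤ g` ⇒ `κ⟦x,y⟧/(x, g)` is finite over `κ` (tree: its dimension is the `y`-order of `g(0,y)`). [folklore] -/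
theorem finite_quot_span_X_zero {g : MvPowerSeries (Fin 2) κ} (hg : ¬ (X 0 : MvPowerSeries (Fin 2) κ) ∣ g) :
    Module.Finite κ (MvPowerSeries (Fin 2) κ ⧸ Ideal.span {(X 0 : MvPowerSeries (Fin 2) κ), g}) := by
  set e : Fin 1 ↪ Fin 2 := ⟨fun _ => (1 : Fin 2), fun a b _ => Subsingleton.elim a b⟩ with he
  have hK : killCompl e g ≠ 0 := by
    intro h0
    apply hg
    have hmem : g ∈ RingHom.ker (killCompl (R := κ) e : MvPowerSeries (Fin 2) κ →+* MvPowerSeries (Fin 1) κ) := by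
      rw [RingHom.mem_ker]
      exact h0
    have h2 := ker_killCompl_le e range_axisEmb hmem
    rw [Set.pair_eq_singleton, Ideal.mem_span_singleton] at h2
    exact h2
  exact (colength_X_eq_order hK).1

/-- If `x ∤ g`, `g ∈ I` and `x^k ∈ I` then `κ⟦x,y⟧/I` is finite over `κ`. [folklore] -/
theorem finite_quot_of_not_X_zero_dvd {I : Ideal (MvPowerSeries (Fin 2) κ)} {g : MvPowerSeries (Fin 2) κ}
    (hg : ¬ (X 0 : MvPowerSeries (Fin 2) κ) ∣ g) (hgI : g ∈ I) {k : ℕ}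
    (hxI : (X 0 : MvPowerSeries (Fin 2) κ) ^ k ∈ I) : Module.Finite κ (MvPowerSeries (Fin 2) κ ⧸ I) := by
  haveI := finite_quot_span_X_zero hg
  obtain ⟨M, hM⟩ := Literature.RingTheory.MvPowerSeries.Jets.exists_maximalIdeal_pow_le_of_finite_quotient
    (Ideal.span {(X 0 : MvPowerSeries (Fin 2) κ), g})
  refine finite_quot_of_maximalIdeal_pow_le (M := M * (k + 1)) ?_
  calc maximalIdeal (MvPowerSeries (Fin 2) κ) ^ (M * (k + 1))
      = (maximalIdeal (MvPowerSeries (Fin 2) κ) ^ M) ^ (k + 1) := pow_mul _ _ _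
    _ ≤ (Ideal.span {(X 0 : MvPowerSeries (Fin 2) κ), g}) ^ (k + 1) := Ideal.pow_right_mono hM _
    _ = (Ideal.span {(X 0 : MvPowerSeries (Fin 2) κ)} ⊔ Ideal.span {g}) ^ (k + 1) := by rw [Ideal.span_insert]
    _ ≤ Ideal.span {(X 0 : MvPowerSeries (Fin 2) κ)} ^ k ⊔ Ideal.span {g} ^ 1 := Ideal.sup_pow_add_le_pow_sup_pow
    _ = Ideal.span {(X 0 : MvPowerSeries (Fin 2) κ) ^ k} ⊔ Ideal.span {g} := by
        rw [Ideal.span_singleton_pow, pow_one]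
    _ ≤ I := sup_le ((Ideal.span_singleton_le_iff_mem _).2 hxI) ((Ideal.span_singleton_le_iff_mem _).2 hgI)

/-! ## The swap automorphism `x ↔ y` -/

/-- The swap substitution `x ↦ y, y ↦ x`. -/
def swapVars (κ : Type) [Field κ] : Fin 2 → MvPowerSeries (Fin 2) κ := ![X 1, X 0]

/-- `hasSubst_swapVars` (planar-field transport toolkit; see the module docstring). [OURS · L1 W4.5c] -/
theorem hasSubst_swapVars : HasSubst (swapVars κ) := HasSubst.X_X

/-- `swapVars_zero` (planar-field transport toolkit; see the module docstring). [OURS · L1 W4.5c] -/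
theorem swapVars_zero : swapVars κ 0 = X 1 := rfl

/-- `swapVars_one` (planar-field transport toolkit; see the module docstring). [OURS · L1 W4.5c] -/
theorem swapVars_one : swapVars κ 1 = X 0 := rfl

/-- `subst_swapVars_X_zero` (planar-field transport toolkit; see the module docstring). [OURS · L1 W4.5c] -/
theorem subst_swapVars_X_zero : subst (swapVars κ) (X 0 : MvPowerSeries (Fin 2) κ) = X 1 := by
  rw [subst_X (R := κ) (hasSubst_swapVars (κ := κ))]; rfl

/-- `subst_swapVars_X_one` (planar-field transport toolkit; see the module docstring). [OURS · L1 W4.5c] -/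
theorem subst_swapVars_X_one : subst (swapVars κ) (X 1 : MvPowerSeries (Fin 2) κ) = X 0 := by
  rw [subst_X (R := κ) (hasSubst_swapVars (κ := κ))]; rfl

/-- The swap is an involution. -/
theorem subst_swapVars_subst_swapVars (f : MvPowerSeries (Fin 2) κ) :
    subst (swapVars κ) (subst (swapVars κ) f) = f := by
  rw [subst_comp_subst_apply (hasSubst_swapVars (κ := κ)) (hasSubst_swapVars (κ := κ))]
  have h : (fun s : Fin 2 => subst (swapVars κ) (swapVars κ s)) = X := by
    funext s
    fin_cases s
    · exact subst_swapVars_X_one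
    · exact subst_swapVars_X_zero
  rw [h, subst_self]
  rfl

/-- The swap as a `κ`-algebra automorphism of `κ⟦x,y⟧`. -/
def swapEquiv : MvPowerSeries (Fin 2) κ ≃ₐ[κ] MvPowerSeries (Fin 2) κ :=
  AlgEquiv.ofAlgHom (substAlgHom hasSubst_swapVars) (substAlgHom hasSubst_swapVars)
    (by ext1 f; simp [subst_swapVars_subst_swapVars])
    (by ext1 f; simp [subst_swapVars_subst_swapVars])

/-- `swapEquiv_apply` (planar-field transport toolkit; see the module docstring). [OURS · L1 W4.5c] -/
theorem swapEquiv_apply (f : MvPowerSeries (Fin 2) κ) : swapEquiv f = subst (swapVars κ) f := by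
  simp [swapEquiv]

/-- If `y ∤ g`, `g ∈ I` and `y^k ∈ I` then `κ⟦x,y⟧/I` is finite over `κ` (swap of the `x`-version). [folklore] -/
theorem finite_quot_of_not_X_one_dvd {I : Ideal (MvPowerSeries (Fin 2) κ)} {g : MvPowerSeries (Fin 2) κ}
    (hg : ¬ (X 1 : MvPowerSeries (Fin 2) κ) ∣ g) (hgI : g ∈ I) {k : ℕ}
    (hyI : (X 1 : MvPowerSeries (Fin 2) κ) ^ k ∈ I) : Module.Finite κ (MvPowerSeries (Fin 2) κ ⧸ I) := by
  set J : Ideal (MvPowerSeries (Fin 2) κ) :=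
    I.map (swapEquiv (κ := κ) : MvPowerSeries (Fin 2) κ →+* MvPowerSeries (Fin 2) κ) with hJ
  have hgJ : subst (swapVars κ) g ∈ J := by
    rw [← swapEquiv_apply]; exact Ideal.mem_map_of_mem _ hgI
  have hxJ : (X 0 : MvPowerSeries (Fin 2) κ) ^ k ∈ J := by
    have h := Ideal.mem_map_of_mem (swapEquiv (κ := κ) : MvPowerSeries (Fin 2) κ →+* MvPowerSeries (Fin 2) κ) hyI
    rw [map_pow] at h
    have h1 : (swapEquiv (κ := κ) : MvPowerSeries (Fin 2) κ →+* MvPowerSeries (Fin 2) κ) (X 1) = X 0 := by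
      rw [RingHom.coe_coe, swapEquiv_apply, subst_swapVars_X_one]
    rwa [h1] at h
  have hg' : ¬ (X 0 : MvPowerSeries (Fin 2) κ) ∣ subst (swapVars κ) g := by
    rintro ⟨w, hw⟩
    apply hg
    refine ⟨subst (swapVars κ) w, ?_⟩
    have := congrArg (subst (swapVars κ)) hw
    rwa [subst_swapVars_subst_swapVars, subst_mul (hasSubst_swapVars (κ := κ)), subst_swapVars_X_zero] at this
  haveI : Module.Finite κ (MvPowerSeries (Fin 2) κ ⧸ J) := finite_quot_of_not_X_zero_dvd hg' hgJ hxJ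
  exact Module.Finite.equiv (Ideal.quotientEquivAlg I J (swapEquiv (κ := κ)) hJ).symm.toLinearEquiv

/-! ## The theorem -/

/-- `hasSubst_chart1` (planar-field transport toolkit; see the module docstring). [OURS · L1 W4.5c] -/
theorem hasSubst_chart1 (c : κ) : HasSubst (chart1 c) :=
  hasSubst_of_constantCoeff_zero fun i => by fin_cases i <;> simp [chart1, constantCoeff_X]

/-- `hasSubst_chart2` (planar-field transport toolkit; see the module docstring). [OURS · L1 W4.5c] -/
theorem hasSubst_chart2 : HasSubst (chart2 (κ := κ)) :=
  hasSubst_of_constantCoeff_zero fun i => by fin_cases i <;> simp [chart2, constantCoeff_X]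

/-- A power of `x` (resp. `y`) lies in the ideal `(a, b)` of an isolated `θ`. -/
theorem exists_X_pow_mem_of_isIsolated (θ : PlanarField κ) (hiso : θ.IsIsolated) (i : Fin 2) :
    ∃ k : ℕ, (X i : MvPowerSeries (Fin 2) κ) ^ k ∈
      Ideal.span ({θ.a, θ.b} : Set (MvPowerSeries (Fin 2) κ)) := by
  haveI : Module.Finite κ (MvPowerSeries (Fin 2) κ ⧸ Ideal.span ({θ.a, θ.b} : Set (MvPowerSeries (Fin 2) κ))) :=
    hiso
  obtain ⟨k, hk⟩ := Literature.RingTheory.MvPowerSeries.Jets.exists_maximalIdeal_pow_le_of_finite_quotient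
    (Ideal.span ({θ.a, θ.b} : Set (MvPowerSeries (Fin 2) κ)))
  exact ⟨k, hk (Ideal.pow_mem_pow (X_mem_maximalIdeal κ (Fin 2) i) k)⟩

/-- Chart 1: the saturated transform of an isolated node is isolated. [OURS · L1 W4.5c] -/
theorem isIsolated_of_isSuccChart1 (c : κ) (θ θ' : PlanarField κ) (hiso : θ.IsIsolated)
    (h : IsSuccChart1 c θ θ') : θ'.IsIsolated := by
  obtain ⟨s, h1, h2, hsat⟩ := h
  obtain ⟨k, hk⟩ := exists_X_pow_mem_of_isIsolated θ hiso 0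
  obtain ⟨u, v, huv⟩ := Ideal.mem_span_pair.1 hk
  have hφ := hasSubst_chart1 (κ := κ) c
  have hk' : subst (chart1 c) u * subst (chart1 c) θ.a + subst (chart1 c) v * subst (chart1 c) θ.b =
      (X 0 : MvPowerSeries (Fin 2) κ) ^ k := by
    have := congrArg (subst (chart1 c)) huv
    rw [subst_add hφ, subst_mul hφ, subst_mul hφ, subst_pow hφ, subst_X hφ] at this
    simpa [chart1] using this
  have hmem : (X 0 : MvPowerSeries (Fin 2) κ) ^ k ∈
      Ideal.span ({θ'.a, θ'.b} : Set (MvPowerSeries (Fin 2) κ)) := by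
    refine Ideal.mem_span_pair.2 ⟨(subst (chart1 c) u + subst (chart1 c) v * (X 1 + C c)) * X 0 ^ s,
      subst (chart1 c) v * X 0 ^ (s + 1), ?_⟩
    linear_combination (subst (chart1 c) u + subst (chart1 c) v * (X 1 + C c)) * h1 +
      subst (chart1 c) v * h2 + hk'
  by_cases ha : (X 0 : MvPowerSeries (Fin 2) κ) ∣ θ'.a
  · have hb : ¬ (X 0 : MvPowerSeries (Fin 2) κ) ∣ θ'.b := fun hb => hsat ⟨ha, hb⟩
    exact finite_quot_of_not_X_zero_dvd hb (Ideal.subset_span (by simp)) hmem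
  · exact finite_quot_of_not_X_zero_dvd ha (Ideal.subset_span (by simp)) hmem

/-- Chart 2: the saturated transform of an isolated node is isolated. [OURS · L1 W4.5c] -/
theorem isIsolated_of_isSuccChart2 (θ θ' : PlanarField κ) (hiso : θ.IsIsolated)
    (h : IsSuccChart2 θ θ') : θ'.IsIsolated := by
  obtain ⟨s, h1, h2, hsat⟩ := h
  obtain ⟨k, hk⟩ := exists_X_pow_mem_of_isIsolated θ hiso 1
  obtain ⟨u, v, huv⟩ := Ideal.mem_span_pair.1 hk
  have hφ := hasSubst_chart2 (κ := κ)
  have hk' : subst chart2 u * subst chart2 θ.a + subst chart2 v * subst chart2 θ.b =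
      (X 1 : MvPowerSeries (Fin 2) κ) ^ k := by
    have := congrArg (subst (chart2 (κ := κ))) huv
    rw [subst_add hφ, subst_mul hφ, subst_mul hφ, subst_pow hφ, subst_X hφ] at this
    simpa [chart2] using this
  have hmem : (X 1 : MvPowerSeries (Fin 2) κ) ^ k ∈
      Ideal.span ({θ'.a, θ'.b} : Set (MvPowerSeries (Fin 2) κ)) := by
    refine Ideal.mem_span_pair.2 ⟨subst chart2 u * X 1 ^ (s + 1),
      (subst chart2 u * X 0 + subst chart2 v) * X 1 ^ s, ?_⟩
    linear_combination subst chart2 u * h2 + (subst chart2 u * X 0 + subst chart2 v) * h1 + hk'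
  by_cases ha : (X 1 : MvPowerSeries (Fin 2) κ) ∣ θ'.a
  · have hb : ¬ (X 1 : MvPowerSeries (Fin 2) κ) ∣ θ'.b := fun hb => hsat ⟨ha, hb⟩
    exact finite_quot_of_not_X_one_dvd hb (Ideal.subset_span (by simp)) hmem
  · exact finite_quot_of_not_X_one_dvd ha (Ideal.subset_span (by simp)) hmem

/-- **`IsolatedSucc`.**  Successors (saturated point-blow-up transforms at `κ`-rational points of the
exceptional line) of an isolated node are isolated.  [OURS · L1 W4.5c] — NOT a statement of the manuscript. -/
theorem isIsolated_of_isSucc (θ θ' : PlanarField κ) (hiso : θ.IsIsolated) (h : θ.IsSucc θ') :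
    θ'.IsIsolated := by
  rcases h with ⟨c, hc⟩ | h2
  · exact isIsolated_of_isSuccChart1 c θ θ' hiso hc
  · exact isIsolated_of_isSuccChart2 θ θ' hiso h2


end Summit.ResolutionOfSingularities.ResolutionOfSingularities.Theorems.WildQuotientResolution.S1.PlanarField

end
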